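import Literature.NumberTheory.Transcendental.KZSemiCanonicalReductionDimOne
import Summits.KontsevichZagierPeriods.KontsevichZagierPeriods.Theorems.HurwitzMicroSectorsNormalFormPrincipleDimOneRatMultiple

/-!
# `NormalFormPrinciple` (stmt-KontsevichZagierPeriods-3869), line `SketchIdeator1` —
# the leaf off the box in dimension one, III: a rational representation on a bounded interval with algebraic ends

Pure proof file (lead seat c4; `--supports` the crux). Let `N = [(a,b), p/q]` be a representation of
KZ's rational shape (`IsRational`: `p, q ∈ ℚ[x₀]`, `q ≠ 0` on the OPEN interval) on a bounded interval
with REAL ALGEBRAIC end points `a < b`. Then the class of `N` modulo the Kontsevich–Zagier relations is a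
mixed normal form (`nfD_of_isRational_interval`):
* bring `p/q` to reduced form `P/Q` over `ℚ` (gcd); a zero of `Q` at an end point would be a pole of
  order `≥ 1` of the integrand, excluded by absolute integrability
  (`KZ.rootMultiplicity_le_of_integrableOn`, Viu-Sos' "no integrable pole in one variable") and
  coprimality — so `Q ≠ 0` on the CLOSED interval `[a,b]`;
* one affine change of variables `x = a + (b − a)t` with algebraic coefficients
  (`AlgSplitK5.affineA_sub_mem_relations`, rule 2) carries `N` to the unit slab with the
  `K`-rational integrand `(b−a)·P(a+(b−a)t)/Q(a+(b−a)t)`, `K = ℚ̄ ∩ ℝ`, pole-free on `[0,1]`;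
* the latter is a mixed normal form by `nfD_of_algK` (file `…DimOneRatMultiple`).

Sources: M. Kontsevich, D. Zagier, *Periods* (2001), §1.2 rules (1), (2); J. Viu-Sos, *A semi-canonical
reduction for periods of Kontsevich–Zagier*, Int. J. Number Theory 17 (2021), §2.3. No definitions are
introduced.
-/

noncomputable section

open MeasureTheory Set Finset
open scoped Polynomial
open Literature.NumberTheory.Transcendental Literature.NumberTheory.Transcendental.KZ
open Literature.ModelTheory.ExponentialFields (IsSemialgebraic isSemialgebraic_univ)

namespace Summit.KontsevichZagierPeriods.HurwitzMicroSectors.NormalFormPrinciple.PiBox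

namespace Dlog

open Summit.KontsevichZagierPeriods.HurwitzMicroSectors.NormalFormPrinciple.Negative
  (setIntegral_fin_one integrableOn_fin_one)

variable {RA : ℝ → ℝ → ℝ → IntegralRep 1} {ZA : ℝ → IntegralRep 0} {RG : ℝ → ℝ → IntegralRep 1}

/-! ## Reduced form on a bounded interval: no pole of the reduced denominator on the closed interval -/

/-- Evaluation of the real image of a rational polynomial is `Polynomial.aeval`. [folklore] -/
theorem eval_map_algebraMap_real (R : ℚ[X]) (t : ℝ) :
    (R.map (algebraMap ℚ ℝ)).eval t = Polynomial.aeval t R := by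
  rw [Polynomial.eval_map, ← Polynomial.aeval_def]

/-- **Reduced form on a bounded interval.** A representation of KZ's rational shape on the slab over
a bounded open interval `(a,b)` has integrand `P/Q` there with `P, Q ∈ ℚ[X]` coprime and `Q` without
zeros on the CLOSED interval `[a,b]`: a zero of the reduced denominator at an end point is a pole of
order `≥ 1` (coprimality), contradicting absolute integrability
(`KZ.rootMultiplicity_le_of_integrableOn`). [cite: ViuSos2021, §2.3] -/
theorem exists_reduced_of_isRational_interval {a b : ℝ} (hab : a < b) (N : IntegralRep 1)
    (hNd : N.domain = {x | x 0 ∈ Set.Ioo a b}) (hN : N.IsRational) :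
    ∃ P Q : ℚ[X], Q ≠ 0 ∧ (∀ t ∈ Set.Icc a b, (Polynomial.aeval t Q : ℝ) ≠ 0) ∧
      EqOn N.integrand (fun x => (Polynomial.aeval (x 0) P : ℝ) / Polynomial.aeval (x 0) Q) N.domain := by
  obtain ⟨pm, qm, hq, hEq⟩ := hN
  set P₀ : ℚ[X] := MvPolynomial.aeval (fun _ : Fin 1 => (Polynomial.X : ℚ[X])) pm with hP₀
  set Q₀ : ℚ[X] := MvPolynomial.aeval (fun _ : Fin 1 => (Polynomial.X : ℚ[X])) qm with hQ₀
  have hQ₀t : ∀ t ∈ Set.Ioo a b, (Polynomial.aeval t Q₀ : ℝ) ≠ 0 := by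
    intro t ht
    have h := hq (fun _ => t) (by rw [hNd]; exact ht)
    rwa [← aeval_fin_one_eq] at h
  have hmid : (a + b) / 2 ∈ Set.Ioo a b := ⟨by linarith, by linarith⟩
  have hQ₀0 : Q₀ ≠ 0 := by
    intro h
    exact hQ₀t _ hmid (by rw [h, map_zero])
  have hEq₀ : EqOn N.integrand (fun x => (Polynomial.aeval (x 0) P₀ : ℝ) / Polynomial.aeval (x 0) Q₀)
      N.domain := fun x hx => by
    rw [hEq hx]
    show MvPolynomial.aeval x pm / MvPolynomial.aeval x qm =
      Polynomial.aeval (x 0) P₀ / Polynomial.aeval (x 0) Q₀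
    rw [← aeval_fin_one_eq pm x, ← aeval_fin_one_eq qm x]
  -- divide by the gcd
  set G := EuclideanDomain.gcd P₀ Q₀ with hG
  have hG0 : G ≠ 0 := fun h => hQ₀0 (EuclideanDomain.gcd_eq_zero_iff.mp h).2
  set P : ℚ[X] := P₀ / G with hP_def
  set Q : ℚ[X] := Q₀ / G with hQ_def
  have hP : P₀ = G * P := (EuclideanDomain.mul_div_cancel' hG0 (EuclideanDomain.gcd_dvd_left P₀ Q₀)).symm
  have hQ : Q₀ = G * Q := (EuclideanDomain.mul_div_cancel' hG0 (EuclideanDomain.gcd_dvd_right P₀ Q₀)).symm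
  have hQ0 : Q ≠ 0 := by
    intro h; apply hQ₀0; rw [hQ, h, mul_zero]
  have hcop : IsCoprime P Q := by
    have h := EuclideanDomain.gcd_eq_gcd_ab P₀ Q₀
    rw [← hG] at h
    refine ⟨EuclideanDomain.gcdA P₀ Q₀, EuclideanDomain.gcdB P₀ Q₀, mul_left_cancel₀ hG0 ?_⟩
    calc G * (EuclideanDomain.gcdA P₀ Q₀ * P + EuclideanDomain.gcdB P₀ Q₀ * Q)
        = (G * P) * EuclideanDomain.gcdA P₀ Q₀ + (G * Q) * EuclideanDomain.gcdB P₀ Q₀ := by ring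
      _ = G := by rw [← hP, ← hQ, ← h]
      _ = G * 1 := (mul_one G).symm
  have hGt : ∀ t ∈ Set.Ioo a b, (Polynomial.aeval t G : ℝ) ≠ 0 := by
    intro t ht h; apply hQ₀t t ht; rw [hQ, map_mul, h, zero_mul]
  have hQt : ∀ t ∈ Set.Ioo a b, (Polynomial.aeval t Q : ℝ) ≠ 0 := by
    intro t ht h; apply hQ₀t t ht; rw [hQ, map_mul, h, mul_zero]
  have hEq' : EqOn N.integrand (fun x => (Polynomial.aeval (x 0) P : ℝ) / Polynomial.aeval (x 0) Q)
      N.domain := by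
    intro x hx
    rw [hEq₀ hx]
    have hx' : x 0 ∈ Set.Ioo a b := by rw [hNd] at hx; exact hx
    show (Polynomial.aeval (x 0) P₀ : ℝ) / Polynomial.aeval (x 0) Q₀ = _
    rw [hP, hQ, map_mul, map_mul, mul_div_mul_left _ _ (hGt (x 0) hx')]
  -- integrability of the reduced integrand on the open interval
  have hint : IntegrableOn (fun t : ℝ => (Polynomial.aeval t P : ℝ) / Polynomial.aeval t Q) (Set.Ioo a b) := by
    have h1 : IntegrableOn (fun x : Fin 1 → ℝ => (Polynomial.aeval (x 0) P : ℝ) / Polynomial.aeval (x 0) Q)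
        N.domain :=
      N.integrableOn.congr_fun hEq' (IsSemialgebraic.measurableSet_holds N.isSemialgebraic_domain)
    rw [hNd, integrableOn_fin_one] at h1
    exact h1
  -- no zero of `Q` on the closed interval
  have hnoroot : ∀ t ∈ Set.Icc a b, (Polynomial.aeval t Q : ℝ) ≠ 0 := by
    intro t ht hQt0
    by_cases hP0 : P = 0
    · -- `P = 0`: `Q` is a unit, a nonzero constant
      have hu : IsUnit Q := by rwa [hP0, isCoprime_zero_left] at hcop
      obtain ⟨c, hc, hcQ⟩ := Polynomial.isUnit_iff.mp hu
      apply hc.ne_zero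
      have h : (Polynomial.aeval t (Polynomial.C c) : ℝ) = 0 := by rw [hcQ]; exact hQt0
      rw [Polynomial.aeval_C, eq_ratCast] at h
      exact_mod_cast h
    · -- `P ≠ 0`: a zero of `Q` in `[a,b]` is a zero of `P` (integrability), contradicting coprimality
      set Pr := P.map (algebraMap ℚ ℝ) with hPr
      set Qr := Q.map (algebraMap ℚ ℝ) with hQr
      have hPr0 : Pr ≠ 0 := (Polynomial.map_ne_zero_iff (algebraMap ℚ ℝ).injective).mpr hP0
      have hQr0 : Qr ≠ 0 := (Polynomial.map_ne_zero_iff (algebraMap ℚ ℝ).injective).mpr hQ0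
      have hint' : IntegrableOn (fun t : ℝ => Pr.eval t / Qr.eval t) (Set.Ioo a b) := by
        simp_rw [hPr, hQr, eval_map_algebraMap_real]; exact hint
      have hle := rootMultiplicity_le_of_integrableOn hPr0 hQr0 hab ht hint'
      have hQroot : Qr.IsRoot t := by rw [Polynomial.IsRoot.def, hQr, eval_map_algebraMap_real]; exact hQt0
      have hpos : 0 < Polynomial.rootMultiplicity t Qr := (Polynomial.rootMultiplicity_pos hQr0).mpr hQroot
      have hProot : Pr.IsRoot t := (Polynomial.rootMultiplicity_pos hPr0).mp (lt_of_lt_of_le hpos hle)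
      have hPt0 : (Polynomial.aeval t P : ℝ) = 0 := by
        rw [← eval_map_algebraMap_real]; exact hProot.eq_zero
      obtain ⟨u, v, huv⟩ := hcop
      have h := congrArg (Polynomial.aeval t) huv
      rw [map_add, map_mul, map_mul, hPt0, hQt0, mul_zero, mul_zero, add_zero, map_one] at h
      exact zero_ne_one h
  exact ⟨P, Q, hQ0, hnoroot, hEq'⟩

/-! ## A rational representation on a bounded interval with algebraic ends is a mixed normal form -/

/-- **A representation of KZ's rational shape on a bounded interval with real algebraic end points
`a < b` is a mixed normal form.** Reduced form (`exists_reduced_of_isRational_interval`), one affine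
move `x = a + (b−a)t` with algebraic coefficients to the unit slab (`AlgSplitK5.affineA_sub_mem_relations`),
whose pull-back integrand `(b−a)P(a+(b−a)t)/Q(a+(b−a)t)` is `K`-rational (`K = ℚ̄ ∩ ℝ`) and pole-free on
`[0,1]`, then `nfD_of_algK`. [cite: KontsevichZagier2001, §1.2 rules (1), (2)] -/
theorem nfD_of_isRational_interval
    (hR : ∀ a b c, IsAlgebraic ℚ a → IsAlgebraic ℚ b → IsAlgebraic ℚ c → 0 < a →
      (RA a b c).domain = {x | x 0 ∈ Set.Ioo a b} ∧ (RA a b c).integrand = fun x => c / x 0)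
    (hZ : ∀ r, IsAlgebraic ℚ r → (ZA r).domain = univ ∧ (ZA r).integrand = fun _ => r)
    (hRG : ∀ t d, IsAlgebraic ℚ t → IsAlgebraic ℚ d →
      (RG t d).domain = {x | x 0 ∈ Set.Ioo 0 t} ∧ (RG t d).integrand = fun x => d / (1 + x 0 ^ 2))
    {a b : ℝ} (ha : IsAlgebraic ℚ a) (hb : IsAlgebraic ℚ b) (hab : a < b)
    (N : IntegralRep 1) (hNd : N.domain = {x | x 0 ∈ Set.Ioo a b}) (hN : N.IsRational) :
    ∃ (r : ℝ) (k : ℕ) (u c : Fin k → ℝ) (k' : ℕ) (t d : Fin k' → ℝ), IsAlgebraic ℚ r ∧ (∀ j, 1 < u j) ∧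
      (∀ j, IsAlgebraic ℚ (u j)) ∧ (∀ j, IsAlgebraic ℚ (c j)) ∧ (∀ l, 0 ≤ t l) ∧
      (∀ l, IsAlgebraic ℚ (t l)) ∧ (∀ l, IsAlgebraic ℚ (d l)) ∧
      QuotientAddGroup.mk' relations (of N) = QuotientAddGroup.mk' relations (of (ZA r)) +
        ∑ j, QuotientAddGroup.mk' relations (of (RA 1 (u j) (c j))) +
        ∑ l, QuotientAddGroup.mk' relations (of (RG (t l) (d l))) := by
  obtain ⟨P, Q, hQ0, hQab, hNi⟩ := exists_reduced_of_isRational_interval hab N hNd hN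
  set K := algebraicClosure ℚ ℝ
  have hs : 0 < b - a := sub_pos.mpr hab
  have hsA : IsAlgebraic ℚ (b - a) := hb.sub ha
  -- the algebraic data as elements of `K`
  set a' : K := ⟨a, mem_algebraicClosure_iff.mpr ha⟩ with ha'
  set s' : K := ⟨b - a, mem_algebraicClosure_iff.mpr hsA⟩ with hs'
  have ea : ((a' : K) : ℝ) = a := rfl
  have es : ((s' : K) : ℝ) = b - a := rfl
  -- the pulled-back integrand over `K`
  set Φp : K[X] := Polynomial.C a' + Polynomial.C s' * Polynomial.X with hΦp
  set Pt : K[X] := Polynomial.C s' * (P.map (algebraMap ℚ K)).comp Φp with hPt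
  set Qt : K[X] := (Q.map (algebraMap ℚ K)).comp Φp with hQt
  have hΦev : ∀ t : ℝ, (Polynomial.aeval t Φp : ℝ) = a + (b - a) * t := by
    intro t
    rw [hΦp, map_add, map_mul, Polynomial.aeval_C, Polynomial.aeval_C, Polynomial.aeval_X]
    rfl
  have hQtev : ∀ t : ℝ, (Polynomial.aeval t Qt : ℝ) = Polynomial.aeval (a + (b - a) * t) Q := by
    intro t
    rw [hQt, Polynomial.aeval_comp, hΦev, Polynomial.aeval_map_algebraMap]
  have hPtev : ∀ t : ℝ, (Polynomial.aeval t Pt : ℝ) = (b - a) * Polynomial.aeval (a + (b - a) * t) P := by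
    intro t
    rw [hPt, map_mul, Polynomial.aeval_C, Polynomial.aeval_comp, hΦev, Polynomial.aeval_map_algebraMap]
    rfl
  have hmem : ∀ t ∈ Set.Icc (0:ℝ) 1, a + (b - a) * t ∈ Set.Icc a b := by
    intro t ht
    constructor <;> nlinarith [ht.1, ht.2, hs]
  have hQt01 : ∀ t ∈ Set.Icc (0:ℝ) 1, (Polynomial.aeval t Qt : ℝ) ≠ 0 := by
    intro t ht
    rw [hQtev]
    exact hQab _ (hmem t ht)
  obtain ⟨T, hTd, hTi⟩ := AlgSplitK5.exists_repK_unit Pt Qt hQt01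
  -- the affine move `x = (b - a) y + a`
  have hmove : of T - of N ∈ relations := by
    refine AlgSplitK5.affineA_sub_mem_relations (s := b - a) (t := a) hsA ha hs.ne' T N
      (fun y => (Polynomial.aeval y P : ℝ) / Polynomial.aeval y Q) ?_ hNi fun x _ => ?_
    · rw [hTd, image_affine_slab_of_pos hs, hNd, mul_zero, zero_add, mul_one, sub_add_cancel]
    · rw [hTi, abs_of_pos hs]
      simp only
      rw [hPtev, hQtev, show a + (b - a) * x 0 = (b - a) * x 0 + a from add_comm _ _]
      ring
  have hcls : QuotientAddGroup.mk' relations (of N) = QuotientAddGroup.mk' relations (of T) := by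
    rw [← QuotientAddGroup.eq_zero_iff] at hmove
    change QuotientAddGroup.mk' relations _ = 0 at hmove
    rw [map_sub, sub_eq_zero] at hmove
    exact hmove.symm
  rw [hcls]
  exact nfD_of_algK hR hZ hRG Pt Qt hQt01 T hTd (by rw [hTi]; exact fun _ _ => rfl)

/-- **Any bounded interval with algebraic ends** (the empty slab, `b ≤ a`, being the zero class).
[cite: KontsevichZagier2001, §1.2 rules (1), (2)] -/
theorem nfD_of_isRational_interval_any
    (hR : ∀ a b c, IsAlgebraic ℚ a → IsAlgebraic ℚ b → IsAlgebraic ℚ c → 0 < a →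
      (RA a b c).domain = {x | x 0 ∈ Set.Ioo a b} ∧ (RA a b c).integrand = fun x => c / x 0)
    (hZ : ∀ r, IsAlgebraic ℚ r → (ZA r).domain = univ ∧ (ZA r).integrand = fun _ => r)
    (hRG : ∀ t d, IsAlgebraic ℚ t → IsAlgebraic ℚ d →
      (RG t d).domain = {x | x 0 ∈ Set.Ioo 0 t} ∧ (RG t d).integrand = fun x => d / (1 + x 0 ^ 2))
    {a b : ℝ} (ha : IsAlgebraic ℚ a) (hb : IsAlgebraic ℚ b)
    (N : IntegralRep 1) (hNd : N.domain = {x | x 0 ∈ Set.Ioo a b}) (hN : N.IsRational) :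
    ∃ (r : ℝ) (k : ℕ) (u c : Fin k → ℝ) (k' : ℕ) (t d : Fin k' → ℝ), IsAlgebraic ℚ r ∧ (∀ j, 1 < u j) ∧
      (∀ j, IsAlgebraic ℚ (u j)) ∧ (∀ j, IsAlgebraic ℚ (c j)) ∧ (∀ l, 0 ≤ t l) ∧
      (∀ l, IsAlgebraic ℚ (t l)) ∧ (∀ l, IsAlgebraic ℚ (d l)) ∧
      QuotientAddGroup.mk' relations (of N) = QuotientAddGroup.mk' relations (of (ZA r)) +
        ∑ j, QuotientAddGroup.mk' relations (of (RA 1 (u j) (c j))) +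
        ∑ l, QuotientAddGroup.mk' relations (of (RG (t l) (d l))) := by
  by_cases hab : a < b
  · exact nfD_of_isRational_interval hR hZ hRG ha hb hab N hNd hN
  · have h0 : QuotientAddGroup.mk' relations (of N) = 0 :=
      (QuotientAddGroup.eq_zero_iff _).mpr (slab_empty_mem_relations N hNd (not_lt.mp hab))
    rw [h0]
    exact nfD_zero hZ

end Dlog

end Summit.KontsevichZagierPeriods.HurwitzMicroSectors.NormalFormPrinciple.PiBox
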